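import Summits.QuantumFields.BalabanUV.Beta.RemainderExplicitHistoryDiagonalRatePowerTailTwo

/-!
# RemainderExplicitHistoryDiagonalRatePowerProfileTwo — ROAD P3, ORDER-0 PROFILE FAMILY: THE FIRST-MOMENT POWER PROFILES
# `ρ(a) = M₀∕((a+1)^q(a+1))`, `1 < q < 2`, REACH THEIR CONTINUUM COUPLING AT THE TWO-SIDED, POINTWISE RATE `√m∕n^q` — tails from above
# `≤ M₀(1+4∕q)∕(k+1)^q` and from below `≥ (M₀∕8)∕(k+1)^q` by Bernoulli for exponents `≥ 1`; END: such a pinned family exists for every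
# `g_IR ∈ ]0,γ]` once `2M₀(1+4∕q)γ ≤ b` (fourth and closing file of station S-d4p3-g50-1; generation 49's census OPEN (i), profile instance)

Cell `pub-balaban`, β-function sub-cell, BINDER row D4 «RemainderConst leaves for Bałaban's split» (`HOME/BINDER-OWNERS.md`; owner
lineage `b2b-balaban-beta-an4`; this file by co-owner #3 lineage `b2b-balaban-beta-d4-p3`, road P3 «the reduction road», generation 50,
station S-d4p3-g50-1, fourth and closing file; imports the station's third file `RemainderExplicitHistoryDiagonalRatePowerTailTwo`),
β-FLOW TEAM duty (1); FREEZE (0) honoured (def-free module in road P3's own `RemainderExplicit*` series; no leaf, no interface, no Literature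
file).  SOURCE OF THE SHAPES ONLY: [Balaban1987RG1] (0.20) p. 256, (0.31) and Thm 2 p. 259, §5 p. 298.  Pure real analysis about ONE
explicit toy family (ours, not Bałaban's).

HONEST FRAMING (page 1 of everything the β sub-cell writes).  *"Discharging BetaPertH makes Bałaban's UV stability UNCONDITIONAL — a real
constructive-QFT result; it is NOT the continuum limit and NOT the Clay problem."*  THIS FILE DISCHARGES NOTHING OF THE KIND.  Generation
49's eighth file priced the tails of the power profile for `0 < q ≤ 1` only (its telescoping step used Bernoulli's inequality for exponents
`≤ 1`); here the step `q∕(v^q·v) ≤ 1∕(v−1)^q − 1∕v^q` is obtained for every `q ≥ 1` from Bernoulli's inequality for exponents `≥ 1`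
(Mathlib's `one_add_mul_self_le_rpow_one_add`), so the profile's tails are two-sided powers for `1 ≤ q ≤ 2` as well, and the third file's
rate applies: for road P3's polynomial profiles `a^{−p}` the census now reads `p ≤ 3∕2`: NOT m-uniform (generation 48); `3∕2 < p < 2` and
`2 < p < 3`: continuum coupling reached at the two-sided pointwise rate `√m∕n^{p−1}` (generations 49–50); `p ∈ {2} ∪ [3, ∞[`: not treated
by these shapes.  Nothing of Bałaban's (1.22) is asserted or constructed; row D4 class UNCHANGED (critical-path width 0; instance 0∕1; D4
DISCHARGE NO DATE); NOT B12 Thm 2, NOT BetaPertH, NOT continuum, NOT Clay.  HONEST DEPENDENCY: continuum YM on T⁴ ⇐ BetaPertH ∧ nine spine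
estimates (0/9 proved); BetaPertH ⇐ (D1) ∧ (D4) ∧ CAP+tail; G-an2-4 gates asym, D1 and NE2/3/4.  ABSOLUTE RULE: nothing is cited as a fact.

WHAT IS PROVED ([folklore]; 0 sorry; 0 `def`).
* §1 `tail_step_of_one_le` (`q ≥ 1`, `v ≥ 2`: `q∕(v^q·v) ≤ 1∕(v−1)^q − 1∕v^q`), `sum_Ico_tail_le` (`k ≥ 1`: `Σ_{a∈[k,N)} 1∕((a+1)^q(a+1))
  ≤ 1∕(q·k^q)`), **`powerProfileTwo_tail_le`** (`1 ≤ q ≤ 2`: tails `≤ M₀(1+4∕q)∕(k+1)^q`), `powerProfileTwo_sum_le` (`Σ_{a<N} ρ_a ≤ M₀(1+4∕q)`),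
  **`powerProfileTwo_tail_ge`** (`0 ≤ q ≤ 2`, `k ≥ 1`, `N ≥ 2k`: tails `≥ (M₀∕8)∕(k+1)^q`).
* §2 **`powerProfileTwo_rate`** (upper, `1 < q < 2`), **`powerProfileTwo_rate_lower_pointwise`** (lower AT `m`, `Wγ < b`),
  END **`exists_family_powerProfileTwo_rate`**.
All letters NOT-IN-PRINT; `BetaFlowAsPrinted S` records a Markov β_n only ⇒ no junction of the as-printed interface changes.
-/

noncomputable section

open Finset Filter Topology

namespace Summit.QuantumFields.BalabanUV.Beta.RemainderExplicitHistoryDiagonalRatePowerProfileTwo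

open Literature.MathematicalPhysics.QuantumFieldTheory.Balaban1983to89
open Literature.MathematicalPhysics.QuantumFieldTheory.Balaban1983to89.FlowStep
open Literature.MathematicalPhysics.QuantumFieldTheory.Balaban1983to89.T4CouplingMatching
open Literature.MathematicalPhysics.QuantumFieldTheory.Balaban1983to89.T4ContinuumCoupling
open Summit.QuantumFields.BalabanUV.Beta.RemainderExplicitHistoryDiagonalRateUniform
open Summit.QuantumFields.BalabanUV.Beta.RemainderExplicitHistoryDiagonalRatePowerTailTwo

variable {β : HBeta} {b γ W : ℝ} {ρ : ℕ → ℝ}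

/-! ## §1 The tails of the power profile for exponents `1 ≤ q ≤ 2` -/

/-- THE TELESCOPING STEP FOR EXPONENTS `q ≥ 1`: for `v ≥ 2`, `q∕(v^q·v) ≤ 1∕(v−1)^q − 1∕v^q` — Bernoulli for exponents `≥ 1`:
`(v∕(v−1))^q = (1 + 1∕(v−1))^q ≥ 1 + q∕(v−1) ≥ 1 + q∕v`. [folklore] -/
theorem tail_step_of_one_le {q v : ℝ} (hq1 : 1 ≤ q) (hv : 2 ≤ v) :
    q / (v ^ q * v) ≤ 1 / (v - 1) ^ q - 1 / v ^ q := by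
  have hv0 : 0 < v := by linarith
  have hv1 : 0 < v - 1 := by linarith
  have hvq : 0 < v ^ q := Real.rpow_pos_of_pos hv0 q
  have hv1q : 0 < (v - 1) ^ q := Real.rpow_pos_of_pos hv1 q
  have hs : (-1 : ℝ) ≤ 1 / (v - 1) := (neg_one_lt_zero.trans (by positivity)).le
  have hb := one_add_mul_self_le_rpow_one_add hs hq1
  have e1 : (1 : ℝ) + 1 / (v - 1) = v / (v - 1) := by field_simp; ring
  rw [e1, Real.div_rpow hv0.le hv1.le] at hb
  have h2 : q / v ≤ q * (1 / (v - 1)) := by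
    rw [mul_one_div]; exact div_le_div_of_nonneg_left (by linarith) hv1 (by linarith)
  have h3 : 1 + q / v ≤ v ^ q / (v - 1) ^ q := by linarith
  have h4 : (1 + q / v) / v ^ q ≤ (v ^ q / (v - 1) ^ q) / v ^ q := div_le_div_of_nonneg_right h3 hvq.le
  have e2 : (v ^ q / (v - 1) ^ q) / v ^ q = 1 / (v - 1) ^ q := by field_simp
  have e3 : (1 + q / v) / v ^ q = 1 / v ^ q + q / (v ^ q * v) := by rw [add_div, div_div, mul_comm]
  rw [e2, e3] at h4
  linarith

/-- THE TELESCOPED `(1+q)`-TAIL FROM ANY START `k ≥ 1` (`q ≥ 1`): `Σ_{a∈[k,N)} 1∕((a+1)^q(a+1)) ≤ 1∕(q·k^q)`. [folklore] -/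
theorem sum_Ico_tail_le {q : ℝ} (hq1 : 1 ≤ q) {k N : ℕ} (hk : 1 ≤ k) (hkN : k ≤ N) :
    ∑ a ∈ Ico k N, 1 / ((((a : ℝ) + 1) ^ q) * ((a : ℝ) + 1)) ≤ 1 / (q * (k : ℝ) ^ q) := by
  have hq0 : 0 < q := by linarith
  have hk0 : (0 : ℝ) < k := by exact_mod_cast hk
  have hkq : 0 < (k : ℝ) ^ q := Real.rpow_pos_of_pos hk0 q
  obtain ⟨d, rfl⟩ := Nat.exists_eq_add_of_le hkN
  have hsum : ∑ a ∈ Ico k (k + d), q / ((((a : ℝ) + 1) ^ q) * ((a : ℝ) + 1)) ≤ 1 / (k : ℝ) ^ q := by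
    rw [Finset.sum_Ico_eq_sum_range, show k + d - k = d by omega]
    calc ∑ t ∈ range d, q / (((((k + t : ℕ) : ℝ) + 1) ^ q) * (((k + t : ℕ) : ℝ) + 1))
        ≤ ∑ t ∈ range d, (1 / (((k + t : ℕ) : ℝ)) ^ q - 1 / ((((k + t : ℕ) : ℝ)) + 1) ^ q) := by
          refine sum_le_sum fun t _ => ?_
          have hk1 : (1 : ℝ) ≤ k := by exact_mod_cast hk
          have h := tail_step_of_one_le (v := ((k + t : ℕ) : ℝ) + 1) hq1
            (by push_cast; have : (0 : ℝ) ≤ t := Nat.cast_nonneg t; linarith)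
          rwa [add_sub_cancel_right] at h
      _ = ∑ t ∈ range d, ((fun t : ℕ => 1 / ((k : ℝ) + t) ^ q) t - (fun t : ℕ => 1 / ((k : ℝ) + t) ^ q) (t + 1)) := by
          refine sum_congr rfl fun t _ => ?_
          push_cast
          ring_nf
      _ = 1 / ((k : ℝ) + ((0 : ℕ) : ℝ)) ^ q - 1 / ((k : ℝ) + ((d : ℕ) : ℝ)) ^ q := Finset.sum_range_sub' _ d
      _ ≤ 1 / (k : ℝ) ^ q := by
          rw [Nat.cast_zero, add_zero]
          have : 0 ≤ 1 / ((k : ℝ) + (d : ℝ)) ^ q := by positivity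
          linarith
  rw [le_div_iff₀ (mul_pos hq0 hkq)]
  calc (∑ a ∈ Ico k (k + d), 1 / ((((a : ℝ) + 1) ^ q) * ((a : ℝ) + 1))) * (q * (k : ℝ) ^ q)
      = (∑ a ∈ Ico k (k + d), q / ((((a : ℝ) + 1) ^ q) * ((a : ℝ) + 1))) * (k : ℝ) ^ q := by
        rw [Finset.sum_mul, Finset.sum_mul]; exact sum_congr rfl fun a _ => by ring
    _ ≤ 1 / (k : ℝ) ^ q * (k : ℝ) ^ q := mul_le_mul_of_nonneg_right hsum hkq.le
    _ = 1 := by field_simp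

/-- THE TAILS OF THE POWER PROFILE FROM ABOVE, `1 ≤ q ≤ 2`: for `ρ(a) = M₀∕((a+1)^q(a+1))` (`M₀ ≥ 0`) and `k ≤ N`,
`Σ_{a<N} ρ(a) − Σ_{a<k} ρ(a) ≤ M₀(1 + 4∕q)∕(k+1)^q` (`k = 0`: the term `a = 0` plus `sum_Ico_tail_le` from `1`; `k ≥ 1`: `1∕(q k^q) ≤ 4∕(q (k+1)^q)`
since `(k+1)^q ≤ 2^q k^q ≤ 4k^q`). [folklore] -/
theorem powerProfileTwo_tail_le {M₀ q : ℝ} (hM₀ : 0 ≤ M₀) (hq1 : 1 ≤ q) (hq2 : q ≤ 2)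
    (hρ : ∀ a, ρ a = M₀ / ((((a : ℝ) + 1) ^ q) * ((a : ℝ) + 1))) {k N : ℕ} (hkN : k ≤ N) :
    ∑ a ∈ range N, ρ a - ∑ a ∈ range k, ρ a ≤ M₀ * (1 + 4 / q) / ((k : ℝ) + 1) ^ q := by
  have hq0 : 0 < q := by linarith
  have hρ0 : ∀ a, 0 ≤ ρ a := fun a => by rw [hρ a]; positivity
  rw [← Finset.sum_Ico_eq_sub _ hkN]
  have hk1 : (0 : ℝ) < (k : ℝ) + 1 := by positivity
  have hk1q : 0 < ((k : ℝ) + 1) ^ q := Real.rpow_pos_of_pos hk1 q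
  have hscale : ∑ a ∈ Ico k N, ρ a = M₀ * ∑ a ∈ Ico k N, 1 / ((((a : ℝ) + 1) ^ q) * ((a : ℝ) + 1)) := by
    rw [Finset.mul_sum]; exact sum_congr rfl fun a _ => by rw [hρ a]; ring
  rcases Nat.eq_zero_or_pos k with hk | hk
  · -- `k = 0`: the `a = 0` term is `M₀`, the rest `≤ M₀∕q`
    subst hk
    simp only [Nat.cast_zero, zero_add, Real.one_rpow, div_one]
    rcases Nat.eq_zero_or_pos N with hN | hN
    · subst hN; simp; nlinarith [div_nonneg (by norm_num : (0:ℝ) ≤ 4) hq0.le]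
    · rw [hscale, Finset.sum_eq_sum_Ico_succ_bot hN]
      simp only [Nat.cast_zero, zero_add, Real.one_rpow, one_mul, div_one]
      have h1 := sum_Ico_tail_le hq1 (k := 1) le_rfl hN
      simp only [Nat.cast_one, Real.one_rpow, mul_one] at h1
      have : 1 + ∑ a ∈ Ico 1 N, 1 / ((((a : ℝ) + 1) ^ q) * ((a : ℝ) + 1)) ≤ 1 + 4 / q := by
        have : 1 / q ≤ 4 / q := div_le_div_of_nonneg_right (by norm_num) hq0.le
        linarith
      exact mul_le_mul_of_nonneg_left this hM₀
  · -- `k ≥ 1`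
    have hk0 : (0 : ℝ) < k := by exact_mod_cast hk
    have hkq : 0 < (k : ℝ) ^ q := Real.rpow_pos_of_pos hk0 q
    have h1 := sum_Ico_tail_le hq1 hk hkN
    have h2q : (2 : ℝ) ^ q ≤ 4 := by
      have := Real.rpow_le_rpow_of_exponent_le (x := 2) (by norm_num) hq2
      rwa [Real.rpow_two, show (2:ℝ) ^ 2 = 4 by norm_num] at this
    have hkk : ((k : ℝ) + 1) ^ q ≤ 4 * (k : ℝ) ^ q := by
      have hk1' : (1 : ℝ) ≤ k := by exact_mod_cast hk
      calc ((k : ℝ) + 1) ^ q ≤ (2 * (k : ℝ)) ^ q := Real.rpow_le_rpow hk1.le (by linarith) hq0.le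
        _ = 2 ^ q * (k : ℝ) ^ q := Real.mul_rpow (by norm_num) hk0.le
        _ ≤ 4 * (k : ℝ) ^ q := mul_le_mul_of_nonneg_right h2q hkq.le
    have h2 : 1 / (q * (k : ℝ) ^ q) ≤ (4 / q) / ((k : ℝ) + 1) ^ q := by
      rw [div_div, div_le_div_iff₀ (by positivity) (by positivity)]
      nlinarith [hq0]
    rw [hscale]
    calc M₀ * ∑ a ∈ Ico k N, 1 / ((((a : ℝ) + 1) ^ q) * ((a : ℝ) + 1)) ≤ M₀ * ((4 / q) / ((k : ℝ) + 1) ^ q) :=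
          mul_le_mul_of_nonneg_left (h1.trans h2) hM₀
      _ ≤ M₀ * (1 + 4 / q) / ((k : ℝ) + 1) ^ q := by
          rw [mul_div_assoc]
          refine mul_le_mul_of_nonneg_left (div_le_div_of_nonneg_right (by linarith) hk1q.le) hM₀

/-- Partial sums of the power profile (`1 ≤ q ≤ 2`): `Σ_{a<N} ρ_a ≤ M₀(1 + 4∕q)` (`powerProfileTwo_tail_le` at `k = 0`). [folklore] -/
theorem powerProfileTwo_sum_le {M₀ q : ℝ} (hM₀ : 0 ≤ M₀) (hq1 : 1 ≤ q) (hq2 : q ≤ 2)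
    (hρ : ∀ a, ρ a = M₀ / ((((a : ℝ) + 1) ^ q) * ((a : ℝ) + 1))) (N : ℕ) :
    ∑ a ∈ range N, ρ a ≤ M₀ * (1 + 4 / q) := by
  have h := powerProfileTwo_tail_le hM₀ hq1 hq2 hρ (Nat.zero_le N)
  simpa using h

/-- THE TAILS OF THE POWER PROFILE FROM BELOW, `0 ≤ q ≤ 2`: `k ≥ 1`, `N ≥ 2k` ⇒ `(M₀∕8)∕(k+1)^q ≤ Σ_{a<N} ρ(a) − Σ_{a<k} ρ(a)` (the block
`a ∈ [k, 2k)` has `k` terms each `≥ M₀∕((2k)^q·2k)`, and `(2k)^q ≤ 4(k+1)^q`). [folklore] -/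
theorem powerProfileTwo_tail_ge {M₀ q : ℝ} (hM₀ : 0 ≤ M₀) (hq0 : 0 ≤ q) (hq2 : q ≤ 2)
    (hρ : ∀ a, ρ a = M₀ / ((((a : ℝ) + 1) ^ q) * ((a : ℝ) + 1))) {k N : ℕ} (hk : 1 ≤ k) (hkN : 2 * k ≤ N) :
    M₀ / 8 / ((k : ℝ) + 1) ^ q ≤ ∑ a ∈ range N, ρ a - ∑ a ∈ range k, ρ a := by
  have hρ0 : ∀ a, 0 ≤ ρ a := fun a => by rw [hρ a]; positivity
  rw [← Finset.sum_Ico_eq_sub _ (by omega : k ≤ N)]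
  have hk0 : (0 : ℝ) < k := by exact_mod_cast hk
  have h2k : (0 : ℝ) < 2 * (k : ℝ) := by positivity
  have h2kq : 0 < (2 * (k : ℝ)) ^ q := Real.rpow_pos_of_pos h2k q
  have hk1q : 0 < ((k : ℝ) + 1) ^ q := Real.rpow_pos_of_pos (by positivity) q
  have hblock : ∑ a ∈ Ico k (2 * k), ρ a ≤ ∑ a ∈ Ico k N, ρ a :=
    Finset.sum_le_sum_of_subset_of_nonneg (Finset.Ico_subset_Ico_right hkN) fun a _ _ => hρ0 a
  have hterm : ∀ a ∈ Ico k (2 * k), M₀ / ((2 * (k : ℝ)) ^ q * (2 * (k : ℝ))) ≤ ρ a := by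
    intro a ha
    have ha' := (Finset.mem_Ico.mp ha).2
    have ha1 : (a : ℝ) + 1 ≤ 2 * k := by exact_mod_cast (by omega : a + 1 ≤ 2 * k)
    have ha0 : (0 : ℝ) < (a : ℝ) + 1 := by positivity
    rw [hρ a]
    refine div_le_div_of_nonneg_left hM₀ (by positivity) ?_
    exact mul_le_mul (Real.rpow_le_rpow ha0.le ha1 hq0) ha1 ha0.le h2kq.le
  have hsum := Finset.card_nsmul_le_sum (Ico k (2 * k)) ρ _ hterm
  rw [Nat.card_Ico, show 2 * k - k = k by omega, nsmul_eq_mul] at hsum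
  refine le_trans ?_ (hsum.trans hblock)
  have e : (k : ℝ) * (M₀ / ((2 * (k : ℝ)) ^ q * (2 * (k : ℝ)))) = M₀ / 2 / (2 * (k : ℝ)) ^ q := by
    field_simp
  rw [e]
  have h2q : (2 : ℝ) ^ q ≤ 4 := by
    have := Real.rpow_le_rpow_of_exponent_le (x := 2) (by norm_num) hq2
    rwa [Real.rpow_two, show (2:ℝ) ^ 2 = 4 by norm_num] at this
  have h2kle : (2 * (k : ℝ)) ^ q ≤ 4 * ((k : ℝ) + 1) ^ q := by
    calc (2 * (k : ℝ)) ^ q ≤ (2 * ((k : ℝ) + 1)) ^ q := Real.rpow_le_rpow h2k.le (by linarith) hq0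
      _ = 2 ^ q * ((k : ℝ) + 1) ^ q := Real.mul_rpow (by norm_num) (by positivity)
      _ ≤ 4 * ((k : ℝ) + 1) ^ q := mul_le_mul_of_nonneg_right h2q hk1q.le
  rw [div_le_div_iff₀ hk1q h2kq]
  nlinarith [hM₀, h2kle, hk1q.le]

/-! ## §2 The rate for the first-moment power profiles -/

/-- **ROAD P3 — THE RATE IN THE CUTOFF FOR THE POWER PROFILE `ρ(a) = M₀∕(a+1)^{1+q}`, `1 < q < 2`, UPPER SIDE.**  A pinned family of runs of
the order-0 profile family with `ρ(a) = M₀∕((a+1)^q(a+1))` (`M₀ > 0`), in ]0,γ], `Σ_{a<N} ρ_a ≤ W`, `Wγ < b`; with `T₀ = M₀(1+4∕q)`: for every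
`m` with `T₀(4q∕(q−1) + 4) ≤ b√b·√m` and every `n ≥ m − 1`, `0 ≤ astar g m − invSq g m n ≤ Λ₈·√m·T₀∕(n+2)^q`
(`Λ₈ = 4∕√b + 64√2κ∕((2−q)(1−Wγ∕b)√b)`). [cite: Balaban1987RG1, (0.20) p.256, (0.31) and Thm 2 p.259] -/
theorem powerProfileTwo_rate {M₀ q : ℝ}
    (hβ : ∀ (k : ℕ) (p : Fin (k + 1) → ℝ),
      β k p = b + ∑ i : Fin (k + 1), ρ (k - i) * min (p (Fin.last k)) (|p (Fin.last k) - p i|))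
    (hb : 0 < b) (hγ : 0 < γ) (hM₀ : 0 < M₀) (hq1 : 1 < q) (hq2 : q < 2)
    (hρ : ∀ a, ρ a = M₀ / ((((a : ℝ) + 1) ^ q) * ((a : ℝ) + 1)))
    (hρW : ∀ n, ∑ a ∈ range n, ρ a ≤ W) (hsmall : W * γ < b)
    {g : ℕ → ℕ → ℝ} {gIR : ℝ} (hrun : ∀ K, RGEqH K β (g K)) (hbox : ∀ K i, i ≤ K → 0 < g K i ∧ g K i ≤ γ)
    (hpin : ∀ K, g K K = gIR) {m n : ℕ}
    (hm : M₀ * (1 + 4 / q) * (4 * q / (q - 1) + 4) ≤ b * Real.sqrt b * Real.sqrt (m : ℝ)) (hmn : m ≤ n + 1) :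
    0 ≤ astar g m - invSq g m n ∧ astar g m - invSq g m n
      ≤ (4 / Real.sqrt b + 8 * Real.sqrt 2 * ((b + W * γ) / b) * (8 / (2 - q)) / ((1 - W * γ / b) * Real.sqrt b))
        * Real.sqrt (m : ℝ) * (M₀ * (1 + 4 / q) / ((((n + 1 : ℕ) : ℝ)) + 1) ^ q) := by
  have hρ0 : ∀ a, 0 ≤ ρ a := fun a => by rw [hρ a]; positivity
  have hT₀ : 0 ≤ M₀ * (1 + 4 / q) := by have : 0 < q := by linarith
                                        positivity
  exact powerTailTwo_rate hβ hb hγ hρ0 hρW hsmall hq1 hq2 hT₀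
    (fun k N hkN => powerProfileTwo_tail_le hM₀.le hq1.le hq2.le hρ hkN) hrun hbox hpin hm hmn

/-- **THE SAME PROFILE, LOWER SIDE, POINTWISE** (`0 ≤ q ≤ 2`, `Wγ < b`): for `1 ≤ m ≤ n+1`,
`√m·(M₀∕8)∕(n+m+1)^q ≤ 8κ₂√b₂(1+Wγ∕b)·(astar g m − invSq g m n)∕(1 − Wγ∕b)` (the station's second file with the minorant `T₁ = M₀∕8`).
[cite: Balaban1987RG1, (0.20) p.256, (0.31) and Thm 2 p.259] -/
theorem powerProfileTwo_rate_lower_pointwise {M₀ q : ℝ}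
    (hβ : ∀ (k : ℕ) (p : Fin (k + 1) → ℝ),
      β k p = b + ∑ i : Fin (k + 1), ρ (k - i) * min (p (Fin.last k)) (|p (Fin.last k) - p i|))
    (hb : 0 < b) (hγ : 0 < γ) (hM₀ : 0 < M₀) (hq0 : 0 ≤ q) (hq2 : q ≤ 2)
    (hρ : ∀ a, ρ a = M₀ / ((((a : ℝ) + 1) ^ q) * ((a : ℝ) + 1)))
    (hρW : ∀ n, ∑ a ∈ range n, ρ a ≤ W) (hsmall : W * γ < b)
    {g : ℕ → ℕ → ℝ} {gIR : ℝ} (hrun : ∀ K, RGEqH K β (g K)) (hbox : ∀ K i, i ≤ K → 0 < g K i ∧ g K i ≤ γ)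
    (hpin : ∀ K, g K K = gIR) {m n : ℕ} (hm : 1 ≤ m) (hmn : m ≤ n + 1) :
    Real.sqrt (m : ℝ) * (M₀ / 8 / ((((n + m : ℕ) : ℝ)) + 1) ^ q)
      ≤ 8 * ((1 / gIR ^ 2 + (b + W * γ)) / b) * Real.sqrt (1 / gIR ^ 2 + (b + W * γ)) * (1 + W * γ / b)
          * ((astar g m - invSq g m n) / (1 - W * γ / b)) := by
  have hρ0 : ∀ a, 0 ≤ ρ a := fun a => by rw [hρ a]; positivity
  exact powerTail_rate_lower_pointwise hβ hb hγ hρ0 hρW hsmall hq0 (by positivity : 0 ≤ M₀ / 8)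
    (fun k N hk hkN => powerProfileTwo_tail_ge hM₀.le hq0 hq2 hρ hk hkN) hrun hbox hpin hm hmn

/-- **END — A FIRST-MOMENT POWER-PROFILE FAMILY WITH ITS RATE TWO-SIDED AT EVERY INFRARED DISTANCE.**  For `ρ(a) = M₀∕((a+1)^q(a+1))`
with `M₀ > 0`, `1 < q < 2`, and `b > 0`, `γ > 0` with `2M₀(1+4∕q)γ ≤ b`, `g_IR ∈ ]0,γ]` (`W = M₀(1+4∕q)`, so `Wγ ≤ b∕2 < b`): there is a pinned
family of runs of the order-0 profile family such that AT EVERY infrared distance `m` with `M₀(1+4∕q)(4q∕(q−1)+4) ≤ b√b√m` and every cutoff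
`n ≥ m − 1`, BOTH `astar g m − invSq g m n ≤ Λ₈·√m·M₀(1+4∕q)∕(n+2)^q` AND
`√m·(M₀∕8)∕(n+m+1)^q ≤ 8κ₂√b₂(1+Wγ∕b)·(astar g m − invSq g m n)∕(1 − Wγ∕b)`. [cite: Balaban1987RG1, (0.20) p.256, (0.31) and Thm 2 p.259] -/
theorem exists_family_powerProfileTwo_rate {M₀ q b γ gIR : ℝ} (hM₀ : 0 < M₀) (hq1 : 1 < q) (hq2 : q < 2)
    (hρ : ∀ a, ρ a = M₀ / ((((a : ℝ) + 1) ^ q) * ((a : ℝ) + 1)))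
    (hb : 0 < b) (hγ : 0 < γ) (hsmall : 2 * (M₀ * (1 + 4 / q)) * γ ≤ b) (hgIR : 0 < gIR) (hgIRγ : gIR ≤ γ) :
    ∃ (β : HBeta) (g : ℕ → ℕ → ℝ),
      (∀ (k : ℕ) (p : Fin (k + 1) → ℝ),
          β k p = b + ∑ i : Fin (k + 1), ρ (k - i) * min (p (Fin.last k)) (|p (Fin.last k) - p i|))
      ∧ (∀ K, RGEqH K β (g K)) ∧ (∀ K i, i ≤ K → 0 < g K i ∧ g K i ≤ γ) ∧ (∀ K, g K K = gIR)
      ∧ (∀ m n : ℕ, M₀ * (1 + 4 / q) * (4 * q / (q - 1) + 4) ≤ b * Real.sqrt b * Real.sqrt (m : ℝ) → m ≤ n + 1 →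
          astar g m - invSq g m n
            ≤ (4 / Real.sqrt b + 8 * Real.sqrt 2 * ((b + M₀ * (1 + 4 / q) * γ) / b) * (8 / (2 - q))
                / ((1 - M₀ * (1 + 4 / q) * γ / b) * Real.sqrt b))
              * Real.sqrt (m : ℝ) * (M₀ * (1 + 4 / q) / ((((n + 1 : ℕ) : ℝ)) + 1) ^ q)
          ∧ Real.sqrt (m : ℝ) * (M₀ / 8 / ((((n + m : ℕ) : ℝ)) + 1) ^ q)
            ≤ 8 * ((1 / gIR ^ 2 + (b + M₀ * (1 + 4 / q) * γ)) / b) * Real.sqrt (1 / gIR ^ 2 + (b + M₀ * (1 + 4 / q) * γ))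
              * (1 + M₀ * (1 + 4 / q) * γ / b)
              * ((astar g m - invSq g m n) / (1 - M₀ * (1 + 4 / q) * γ / b))) := by
  let β : HBeta := fun k p => b + ∑ i : Fin (k + 1), ρ (k - i) * min (p (Fin.last k)) (|p (Fin.last k) - p i|)
  have hβ : ∀ (k : ℕ) (p : Fin (k + 1) → ℝ),
      β k p = b + ∑ i : Fin (k + 1), ρ (k - i) * min (p (Fin.last k)) (|p (Fin.last k) - p i|) := fun k p => rfl
  have hq0 : 0 < q := by linarith
  have hρ0 : ∀ a, 0 ≤ ρ a := fun a => by rw [hρ a]; positivity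
  have hρW := powerProfileTwo_sum_le hM₀.le hq1.le hq2.le hρ
  have hW0 : 0 < M₀ * (1 + 4 / q) := by positivity
  have hsmall' : (M₀ * (1 + 4 / q)) * γ < b := by nlinarith [mul_pos hW0 hγ]
  obtain ⟨g, hrun, hbox, hpin⟩ :=
    RemainderExplicitHistoryDiagonalProfile.runFamily_exists (W := M₀ * (1 + 4 / q)) hβ hb hγ hρ0 hρW hsmall hgIR hgIRγ
  refine ⟨β, g, hβ, hrun, hbox, hpin, fun m n hm hmn => ⟨?_, ?_⟩⟩
  · exact (powerProfileTwo_rate hβ hb hγ hM₀ hq1 hq2 hρ hρW hsmall' hrun hbox hpin hm hmn).2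
  · have hm1 : 1 ≤ m := by
      by_contra h0
      have hm0 : m = 0 := by omega
      rw [hm0, Nat.cast_zero, Real.sqrt_zero, mul_zero] at hm
      have : 0 < M₀ * (1 + 4 / q) * (4 * q / (q - 1) + 4) := by
        have : 0 < q - 1 := by linarith
        positivity
      linarith
    exact powerProfileTwo_rate_lower_pointwise hβ hb hγ hM₀ hq0.le hq2.le hρ hρW hsmall' hrun hbox hpin hm1 hmn

end Summit.QuantumFields.BalabanUV.Beta.RemainderExplicitHistoryDiagonalRatePowerProfileTwo

end
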